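import Literature.AnabelianGeometry.EtaleTheta.TemperedRigidity
import Literature.AnabelianGeometry.SemiGraphs.TemperedCompletionExtension
import HarnessLib

/-!
# [EtTh] Theorem 1.6 (i)(ii): the profinite completion isomorphism and the theta companion induced by
# an isomorphism of tempered fundamental groups (sub-DAG `EtTh:Thm1.6`, part 1 — PROVED junctions)

Mochizuki, *The étale theta function …*, Publ. RIMS **45** (2009), Thm. 1.6, PRIMS PDF pp. 24–25
(printed 250–251) [cite: MochizukiEtTh2009, Thm 1.6 p.24]. abc-iut cell, layer L2, D-0068 (1)
statements-first sub-DAG (index: `plan/L2/SUBDAG-EtTh-Thm16.md`, rows T16/L01, L06–L10; seat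
abc-iut-L6-d5, §K row K3). Companion of abc-iut-L2-t1's typed node `TemperedRigidity.lean`
(`ThetaSetting.Thm16i`, `ThetaSetting.ThetaCompanion`, `ThetaSetting.transport`); nothing there is
restated or edited.

Printed proof (p. 24): "Assertion (i) is immediate from the definitions; the discreteness of the
topological group “Z”; and the fact that γ maps Δ^tp_{Xα} onto Δ^tp_{Xβ} [cf. [Mzk2], Lemma 1.3.8]
and preserves decomposition groups of cusps [cf. [Mzk14], Theorem 6.5, (iii)]. As for assertion (ii),
the fact that γ induces an isomorphism (Δ_Θ)α ⥲ (Δ_Θ)β is immediate [in light of the argument used to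
verify assertion (i)] from the definitions."

What this file PROVES over the root interface `ThetaSetting` (`Setting.lean`) and the L3 interface
`SemiGraphs.TemperedCurve` (profinite completion `toHat`, `IsProfiniteCompletion`, with abc-iut-w5-d139's
universal property `IsProfiniteCompletion.exists_extension` / `extension_unique`):
* `Thm16Sub.completionIso` — an isomorphism of tempered groups `γ : Π^tp_{Xα} ⥲ Π^tp_{Xβ}` extends
  uniquely to the profinite completions, `γ̂ ∘ toHat = toHat ∘ γ` (row L06);
* `Thm16Sub.map_deltaHat_eq` / `hΔ_of_map_deltaHat_eq` — "γ maps Δ^tp_{Xα} onto Δ^tp_{Xβ}" is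
  EQUIVALENT to "γ̂ maps Δ_{Xα} onto Δ_{Xβ}" ([AbsAnab] Lem. 1.3.8 in tempered resp. profinite form;
  rows L01/L07);
* `Thm16Sub.map_ker_toTheta_eq`, `map_ker_toEll_eq` — from (hΔ), γ carries the kernels of
  `Π^tp_X ↠ (Π^tp_X)^Θ ↠ (Π^tp_X)^ell` onto each other (their kernels are DEFINED through
  `[Δ_X,[Δ_X,Δ_X]]⁻`, `[Δ_X,Δ_X]⁻`, root fields `ker_toTheta`, `ker_toEll`; row L08);
* `Thm16Sub.algCompanion` (+ `_apply_toTheta`, `_map_deltaTheta`, `_unique`) — the ALGEBRAIC theta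
  companion: "γ induces an isomorphism (Δ_Θ)α ⥲ (Δ_Θ)β" as an isomorphism of abstract groups of the
  theta quotients compatible with γ (row L09);
* `Thm16Sub.thetaCompanion_of_isQuotientMap` — abc-iut-L2-t1's `ThetaCompanion γ` (which asks for a
  HOMEOMORPHIC companion) follows once `toTheta` is known to be a topological quotient map on both
  sides — a datum the root does not record (row L10, debt R3 of the sub-DAG);
The companion file `Thm16SubdagStatements.lean` (same seat) assembles (i) (rows L00(i), L02) and
STATES the printed characterisations the root interface does not carry (`KerToZIsCompactlyGenerated`,
`GKNIsKernelOfAction`, `GtpYNFromCusp`, rows L02/L04/L05); the cohomological half of (ii) and (iii)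
(rows L11–L15) is a third file. No new `Prop`-valued fact is introduced here. HONEST FRAMING: [EtTh] is
refereed and undisputed; typed ≠ proved; nothing here takes a side on [IUTchIII] Cor. 3.12.
-/

noncomputable section

namespace Literature.AnabelianGeometry.EtaleTheta

open Literature.AnabelianGeometry.SemiGraphs Topology

namespace Thm16Sub

variable {p : ℕ} [Fact p.Prime]

/-! ### Two transport lemmas for (topological) group isomorphisms -/

section Transport

variable {A B Ah Bh : Type*} [Group A] [Group B] [Group Ah] [Group Bh]

/-- Subgroups cut out through compatible maps `i : A → Â`, `j : B → B̂` (`j ∘ γ = γ̂ ∘ i`) correspond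
under `γ`: `γ(i⁻¹ S) = j⁻¹(γ̂ S)`. [cite: MochizukiEtTh2009, Thm 1.6 (ii) p.24] -/
theorem map_comap_eq_comap_map (γ : A ≃* B) (γhat : Ah ≃* Bh) (i : A →* Ah) (j : B →* Bh)
    (hcomm : ∀ a, j (γ a) = γhat (i a)) (S : Subgroup Ah) :
    (S.comap i).map γ.toMonoidHom = (S.map γhat.toMonoidHom).comap j := by
  ext y
  constructor
  · rintro ⟨x, hx, rfl⟩
    exact ⟨i x, hx, (hcomm x).symm⟩
  · rintro ⟨s, hs, hsy⟩
    refine ⟨γ.symm y, ?_, γ.apply_symm_apply y⟩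
    change i (γ.symm y) ∈ S
    have h1 : j y = γhat (i (γ.symm y)) := by rw [← hcomm, MulEquiv.apply_symm_apply]
    have h2 : γhat (i (γ.symm y)) = γhat s := by rw [← h1]; exact hsy.symm
    rwa [γhat.injective h2]

variable [TopologicalSpace A] [TopologicalSpace B] [IsTopologicalGroup A] [IsTopologicalGroup B]

/-- A homeomorphic group isomorphism carries topological closures of subgroups to topological
closures. [cite: MochizukiEtTh2009, Thm 1.6 (ii) p.24] -/
theorem map_topologicalClosure (e : A ≃ₜ* B) (s : Subgroup A) :
    s.topologicalClosure.map e.toMulEquiv.toMonoidHom = (s.map e.toMulEquiv.toMonoidHom).topologicalClosure := by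
  apply SetLike.coe_injective
  change (e.toMulEquiv.toMonoidHom : A → B) '' (closure (s : Set A)) =
    closure ((e.toMulEquiv.toMonoidHom : A → B) '' (s : Set A))
  exact e.toHomeomorph.image_closure (s : Set A)

end Transport

/-! ### L06: the isomorphism of profinite completions induced by `γ` -/

section Completion

variable (X Y : TemperedCurve p)

/-- `toHat ∘ γ : Π^tp_X → Π_Y` extends along `Π^tp_X → Π_X` (universal property of the profinite
completion, abc-iut-w5-d139). [cite: MochizukiEtTh2009, Thm 1.6 (ii) p.24] -/
theorem exists_completionHom (γ : X.PiTemp →ₜ* Y.PiTemp) :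
    ∃ Φ : X.PiHat →ₜ* Y.PiHat, ∀ x, Φ (X.toHat x) = Y.toHat (γ x) := by
  haveI : CompactSpace Y.PiHat := Y.isProfiniteCompletion_toHat.compactSpace
  haveI : TotallyDisconnectedSpace Y.PiHat := Y.isProfiniteCompletion_toHat.totallyDisconnectedSpace
  exact IsProfiniteCompletion.exists_extension X.isProfiniteCompletion_toHat (Y.toHat.comp γ)

/-- A chosen continuous extension `Φ_γ : Π_X → Π_Y` of `toHat ∘ γ`. [cite: MochizukiEtTh2009, Thm 1.6 (ii) p.24] -/
def completionHom (γ : X.PiTemp →ₜ* Y.PiTemp) : X.PiHat →ₜ* Y.PiHat :=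
  (exists_completionHom X Y γ).choose

/-- `Φ_γ ∘ toHat = toHat ∘ γ`. [cite: MochizukiEtTh2009, Thm 1.6 (ii) p.24] -/
theorem completionHom_toHat (γ : X.PiTemp →ₜ* Y.PiTemp) (x : X.PiTemp) :
    completionHom X Y γ (X.toHat x) = Y.toHat (γ x) :=
  (exists_completionHom X Y γ).choose_spec x

/-- An isomorphism of topological groups as a continuous homomorphism (plumbing). [cite: MochizukiEtTh2009, Thm 1.6 (ii) p.24] -/
def toCMH (γ : X.PiTemp ≃ₜ* Y.PiTemp) : X.PiTemp →ₜ* Y.PiTemp :=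
  { toMonoidHom := γ.toMulEquiv.toMonoidHom, continuous_toFun := γ.continuous }

/-- `toCMH γ` is `γ` on elements. [cite: MochizukiEtTh2009, Thm 1.6 (ii) p.24] -/
@[simp] theorem toCMH_apply (γ : X.PiTemp ≃ₜ* Y.PiTemp) (x : X.PiTemp) : toCMH X Y γ x = γ x := rfl

/-- `Φ_{γ⁻¹} ∘ Φ_γ = id` (uniqueness of extensions along a dense map into a Hausdorff group).
[cite: MochizukiEtTh2009, Thm 1.6 (ii) p.24] -/
theorem completionHom_symm_comp (γ : X.PiTemp ≃ₜ* Y.PiTemp) (z : X.PiHat) :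
    completionHom Y X (toCMH Y X γ.symm) (completionHom X Y (toCMH X Y γ) z) = z := by
  haveI : T2Space X.PiHat := X.isProfiniteCompletion_toHat.t2Space
  have h := IsProfiniteCompletion.extension_unique X.isProfiniteCompletion_toHat
    ((completionHom Y X (toCMH Y X γ.symm)).comp (completionHom X Y (toCMH X Y γ)))
    (ContinuousMonoidHom.id X.PiHat) (fun x => by
      change completionHom Y X _ (completionHom X Y _ (X.toHat x)) = X.toHat x
      rw [completionHom_toHat, toCMH_apply, completionHom_toHat, toCMH_apply,
        ContinuousMulEquiv.symm_apply_apply])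
  exact DFunLike.congr_fun h z

/-- **L06.** The isomorphism of profinite completions `γ̂ : Π_{Xα} ⥲ Π_{Xβ}` induced by an
isomorphism of tempered fundamental groups `γ` (extension by the universal property in both
directions; mutually inverse by uniqueness). [cite: MochizukiEtTh2009, Thm 1.6 (ii) p.24] -/
def completionIso (γ : X.PiTemp ≃ₜ* Y.PiTemp) : X.PiHat ≃ₜ* Y.PiHat :=
  { toFun := completionHom X Y (toCMH X Y γ)
    invFun := completionHom Y X (toCMH Y X γ.symm)
    left_inv := fun z => completionHom_symm_comp X Y γ z
    right_inv := fun z => by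
      have h := completionHom_symm_comp Y X γ.symm z
      rwa [ContinuousMulEquiv.symm_symm] at h
    map_mul' := fun a b => map_mul _ a b
    continuous_toFun := (completionHom X Y (toCMH X Y γ)).continuous
    continuous_invFun := (completionHom Y X (toCMH Y X γ.symm)).continuous }

/-- `γ̂ ∘ toHat = toHat ∘ γ`. [cite: MochizukiEtTh2009, Thm 1.6 (ii) p.24] -/
theorem completionIso_toHat (γ : X.PiTemp ≃ₜ* Y.PiTemp) (x : X.PiTemp) :
    completionIso X Y γ (X.toHat x) = Y.toHat (γ x) :=
  completionHom_toHat X Y (toCMH X Y γ) x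

/-- `γ̂ ∘ toHat = toHat ∘ γ`, bundled-hom form. [cite: MochizukiEtTh2009, Thm 1.6 (ii) p.24] -/
theorem completionIso_toHat' (γ : X.PiTemp ≃ₜ* Y.PiTemp) (x : X.PiTemp) :
    Y.toHat.toMonoidHom (γ.toMulEquiv x) = (completionIso X Y γ).toMulEquiv (X.toHat.toMonoidHom x) :=
  (completionIso_toHat X Y γ x).symm

/-! ### L01/L07: [AbsAnab] Lemma 1.3.8 in tempered and in profinite form are equivalent -/

/-- **L07 ⇐ L01.** If `γ(Δ^tp_{Xα}) = Δ^tp_{Xβ}` then `γ̂(Δ_{Xα}) = Δ_{Xβ}` (`Δ_X` is the closure of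
the image of `Δ^tp_X`, [SemiAnbd] p. 69). [cite: MochizukiEtTh2009, Thm 1.6 (i) p.24] -/
theorem map_deltaHat_eq (γ : X.PiTemp ≃ₜ* Y.PiTemp)
    (hΔ : X.DeltaTemp.map γ.toMulEquiv.toMonoidHom = Y.DeltaTemp) :
    X.DeltaHat.map (completionIso X Y γ).toMulEquiv.toMonoidHom = Y.DeltaHat := by
  rw [TemperedCurve.DeltaHat, map_topologicalClosure, Subgroup.map_map, TemperedCurve.DeltaHat, ← hΔ,
    Subgroup.map_map]
  congr 2
  ext x
  exact (completionIso_toHat X Y γ x)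

/-- **L01 ⇐ L07.** Conversely `γ̂(Δ_{Xα}) = Δ_{Xβ}` gives `γ(Δ^tp_{Xα}) = Δ^tp_{Xβ}`, because
`Δ^tp_X = Π^tp_X ∩ Δ_X` (`ThetaSetting.comap_toHat_deltaHat`, p. 12). So the tempered form (hΔ) of
[AbsAnab] Lem. 1.3.8 used throughout L3 and its profinite form `PreservesGeom` (L4) are interchangeable.
[cite: MochizukiEtTh2009, Thm 1.6 (i) p.24] -/
theorem hΔ_of_map_deltaHat_eq (Dα Dβ : ThetaSetting p) (γ : Dα.PiTemp ≃ₜ* Dβ.PiTemp)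
    (h : Dα.DeltaHat.map (completionIso Dα.toTemperedCurve Dβ.toTemperedCurve γ).toMulEquiv.toMonoidHom =
      Dβ.DeltaHat) :
    Dα.DeltaTemp.map γ.toMulEquiv.toMonoidHom = Dβ.DeltaTemp := by
  rw [← Dα.comap_toHat_deltaHat, ← Dβ.comap_toHat_deltaHat,
    map_comap_eq_comap_map γ.toMulEquiv (completionIso _ _ γ).toMulEquiv Dα.toHat.toMonoidHom
      Dβ.toHat.toMonoidHom (completionIso_toHat' _ _ γ), h]

end Completion

/-! ### L08: γ preserves the kernels of `Π^tp_X ↠ (Π^tp_X)^Θ ↠ (Π^tp_X)^ell` -/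

section Kernels

variable (Dα Dβ : ThetaSetting p) (γ : Dα.PiTemp ≃ₜ* Dβ.PiTemp)
  (hΔ : Dα.DeltaTemp.map γ.toMulEquiv.toMonoidHom = Dβ.DeltaTemp)

include hΔ in
/-- `γ̂` carries `[Δ_{Xα}, Δ_{Xα}]⁻` onto `[Δ_{Xβ}, Δ_{Xβ}]⁻`. [cite: MochizukiEtTh2009, Thm 1.6 (ii) p.24] -/
theorem map_commutatorClosure_eq :
    (⁅Dα.DeltaHat, Dα.DeltaHat⁆.topologicalClosure).map (completionIso Dα.toTemperedCurve Dβ.toTemperedCurve γ).toMulEquiv.toMonoidHom =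
      ⁅Dβ.DeltaHat, Dβ.DeltaHat⁆.topologicalClosure := by
  rw [map_topologicalClosure, Subgroup.map_commutator, map_deltaHat_eq _ _ γ hΔ]

include hΔ in
/-- `γ̂` carries `[[Δ,Δ],Δ]⁻` for `Xα` onto that for `Xβ`. [cite: MochizukiEtTh2009, Thm 1.6 (ii) p.24] -/
theorem map_tripleCommutatorClosure_eq :
    (⁅⁅Dα.DeltaHat, Dα.DeltaHat⁆, Dα.DeltaHat⁆.topologicalClosure).map (completionIso Dα.toTemperedCurve Dβ.toTemperedCurve γ).toMulEquiv.toMonoidHom =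
      ⁅⁅Dβ.DeltaHat, Dβ.DeltaHat⁆, Dβ.DeltaHat⁆.topologicalClosure := by
  rw [map_topologicalClosure, Subgroup.map_commutator, Subgroup.map_commutator,
    map_deltaHat_eq _ _ γ hΔ]

include hΔ in
/-- **L08 (theta).** `γ(Ker(Π^tp_{Xα} ↠ (Π^tp_{Xα})^Θ)) = Ker(Π^tp_{Xβ} ↠ (Π^tp_{Xβ})^Θ)` — "γ induces an
isomorphism … is immediate from the definitions" (the kernel is defined by `[Δ_X,[Δ_X,Δ_X]]`, p. 12).
[cite: MochizukiEtTh2009, Thm 1.6 (ii) p.24] -/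
theorem map_ker_toTheta_eq : Dα.toTheta.ker.map γ.toMulEquiv.toMonoidHom = Dβ.toTheta.ker := by
  rw [Dα.ker_toTheta, Dβ.ker_toTheta,
    map_comap_eq_comap_map γ.toMulEquiv (completionIso Dα.toTemperedCurve Dβ.toTemperedCurve γ).toMulEquiv Dα.toHat.toMonoidHom Dβ.toHat.toMonoidHom
      (completionIso_toHat' _ _ γ), map_tripleCommutatorClosure_eq Dα Dβ γ hΔ]

include hΔ in
/-- **L08 (ell).** `γ(Ker(Π^tp_{Xα} ↠ (Π^tp_{Xα})^ell)) = Ker(Π^tp_{Xβ} ↠ (Π^tp_{Xβ})^ell)`.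
[cite: MochizukiEtTh2009, Thm 1.6 (ii) p.24] -/
theorem map_ker_toEll_eq :
    (Dα.thetaToEll.comp Dα.toTheta).ker.map γ.toMulEquiv.toMonoidHom = (Dβ.thetaToEll.comp Dβ.toTheta).ker := by
  rw [Dα.ker_toEll, Dβ.ker_toEll,
    map_comap_eq_comap_map γ.toMulEquiv (completionIso Dα.toTemperedCurve Dβ.toTemperedCurve γ).toMulEquiv Dα.toHat.toMonoidHom Dβ.toHat.toMonoidHom
      (completionIso_toHat' _ _ γ), map_commutatorClosure_eq Dα Dβ γ hΔ]

end Kernels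

/-! ### L09/L10: the theta companion of `γ` -/

section Companion

variable (Dα Dβ : ThetaSetting p) (γ : Dα.PiTemp ≃ₜ* Dβ.PiTemp)
  (hΔ : Dα.DeltaTemp.map γ.toMulEquiv.toMonoidHom = Dβ.DeltaTemp)

include hΔ in
/-- `Ker((·)^Θ_α) ≤ Ker((·)^Θ_β ∘ γ)`. [cite: MochizukiEtTh2009, Thm 1.6 (ii) p.24] -/
theorem ker_le_ker_comp : Dα.toTheta.ker ≤ (Dβ.toTheta.comp γ.toMulEquiv.toMonoidHom).ker := by
  intro x hx
  have : γ.toMulEquiv x ∈ Dβ.toTheta.ker := by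
    rw [← map_ker_toTheta_eq Dα Dβ γ hΔ]; exact ⟨x, hx, rfl⟩
  exact this

/-- The forward map `(Π^tp_{Xα})^Θ → (Π^tp_{Xβ})^Θ` induced by `γ`. [cite: MochizukiEtTh2009, Thm 1.6 (ii) p.24] -/
def companionHom : Dα.GtpTheta →* Dβ.GtpTheta :=
  Dα.toTheta.liftOfSurjective Dα.toTheta_surjective
    ⟨Dβ.toTheta.comp γ.toMulEquiv.toMonoidHom, ker_le_ker_comp Dα Dβ γ hΔ⟩

/-- The forward map on `(·)^Θ` of elements. [cite: MochizukiEtTh2009, Thm 1.6 (ii) p.24] -/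
theorem companionHom_apply (x : Dα.PiTemp) :
    companionHom Dα Dβ γ hΔ (Dα.toTheta x) = Dβ.toTheta (γ.toMulEquiv x) :=
  Dα.toTheta.liftOfRightInverse_comp_apply _ _ _ x

include hΔ in
/-- (hΔ) for `γ⁻¹`. [cite: MochizukiEtTh2009, Thm 1.6 (i) p.24] -/
theorem hΔ_symm : Dβ.DeltaTemp.map γ.symm.toMulEquiv.toMonoidHom = Dα.DeltaTemp := by
  rw [← hΔ, Subgroup.map_map]
  convert Subgroup.map_id _
  ext x
  exact γ.symm_apply_apply x

/-- The backward map inverts the forward map. [cite: MochizukiEtTh2009, Thm 1.6 (ii) p.24] -/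
theorem companionHom_symm_comp (g : Dα.GtpTheta) :
    companionHom Dβ Dα γ.symm (hΔ_symm Dα Dβ γ hΔ) (companionHom Dα Dβ γ hΔ g) = g := by
  obtain ⟨x, rfl⟩ := Dα.toTheta_surjective g
  rw [companionHom_apply, companionHom_apply]
  exact congrArg Dα.toTheta (γ.symm_apply_apply x)

/-- **L09.** The ALGEBRAIC theta companion of `γ`: the isomorphism of abstract groups
`(Π^tp_{Xα})^Θ ⥲ (Π^tp_{Xβ})^Θ` induced by `γ` ("γ induces an isomorphism (Δ_Θ)α ⥲ (Δ_Θ)β", p. 24),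
granted (hΔ). [cite: MochizukiEtTh2009, Thm 1.6 (ii) p.24] -/
def algCompanion : Dα.GtpTheta ≃* Dβ.GtpTheta :=
  MonoidHom.toMulEquiv (companionHom Dα Dβ γ hΔ) (companionHom Dβ Dα γ.symm (hΔ_symm Dα Dβ γ hΔ))
    (MonoidHom.ext fun g => companionHom_symm_comp Dα Dβ γ hΔ g)
    (MonoidHom.ext fun g => by
      obtain ⟨y, rfl⟩ := Dβ.toTheta_surjective g
      simp only [MonoidHom.comp_apply, MonoidHom.id_apply]
      rw [companionHom_apply, companionHom_apply]
      exact congrArg Dβ.toTheta (γ.apply_symm_apply y))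

/-- `γ^Θ ∘ (·)^Θ = (·)^Θ ∘ γ` (the field `ThetaCompanion.comm`). [cite: MochizukiEtTh2009, Thm 1.6 (ii) p.24] -/
theorem algCompanion_apply_toTheta (x : Dα.PiTemp) :
    algCompanion Dα Dβ γ hΔ (Dα.toTheta x) = Dβ.toTheta (γ.toMulEquiv x) :=
  companionHom_apply Dα Dβ γ hΔ x

/-- `Δ_Θ = Ker((Π^tp_X)^Θ ↠ (Π^tp_X)^ell)` is the image of `Ker(Π^tp_X ↠ (Π^tp_X)^ell)`.
[cite: MochizukiEtTh2009, §1 p.12] -/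
theorem deltaTheta_eq_map_ker (D : ThetaSetting p) :
    D.DeltaTheta = (D.thetaToEll.comp D.toTheta).ker.map D.toTheta := by
  ext g
  constructor
  · intro hg
    obtain ⟨x, rfl⟩ := D.toTheta_surjective g
    exact ⟨x, hg, rfl⟩
  · rintro ⟨x, hx, rfl⟩
    exact hx

/-- **L09, `Δ_Θ` clause.** `γ^Θ((Δ_Θ)α) = (Δ_Θ)β` (the field `ThetaCompanion.map_deltaTheta`).
[cite: MochizukiEtTh2009, Thm 1.6 (ii) p.24] -/
theorem algCompanion_map_deltaTheta :
    Dα.DeltaTheta.map (algCompanion Dα Dβ γ hΔ).toMonoidHom = Dβ.DeltaTheta := by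
  rw [deltaTheta_eq_map_ker Dα, deltaTheta_eq_map_ker Dβ, ← map_ker_toEll_eq Dα Dβ γ hΔ,
    Subgroup.map_map, Subgroup.map_map]
  congr 1
  ext x
  exact algCompanion_apply_toTheta Dα Dβ γ hΔ x

/-- Uniqueness: an isomorphism of the theta quotients compatible with `γ` IS `algCompanion`
(`toTheta` is surjective). [cite: MochizukiEtTh2009, Thm 1.6 (ii) p.24] -/
theorem algCompanion_unique (θ : Dα.GtpTheta ≃* Dβ.GtpTheta)
    (hθ : ∀ x : Dα.PiTemp, θ (Dα.toTheta x) = Dβ.toTheta (γ.toMulEquiv x)) :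
    θ = algCompanion Dα Dβ γ hΔ := by
  apply MulEquiv.ext
  intro g
  obtain ⟨x, rfl⟩ := Dα.toTheta_surjective g
  rw [hθ, algCompanion_apply_toTheta]

/-- In particular abc-iut-L2-t1's (topological) theta companions are unique as maps.
[cite: MochizukiEtTh2009, Thm 1.6 (ii) p.24] -/
theorem thetaCompanion_thetaIso_eq (c : ThetaSetting.ThetaCompanion γ) :
    c.thetaIso.toMulEquiv = algCompanion Dα Dβ γ hΔ :=
  algCompanion_unique Dα Dβ γ hΔ c.thetaIso.toMulEquiv fun x => (c.comm x).symm

/-- `(γ^Θ)⁻¹ ∘ (·)^Θ = (·)^Θ ∘ γ⁻¹`. [cite: MochizukiEtTh2009, Thm 1.6 (ii) p.24] -/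
theorem algCompanion_symm_apply_toTheta (y : Dβ.PiTemp) :
    (algCompanion Dα Dβ γ hΔ).symm (Dβ.toTheta y) = Dα.toTheta (γ.symm.toMulEquiv y) := by
  apply (algCompanion Dα Dβ γ hΔ).injective
  rw [MulEquiv.apply_symm_apply, algCompanion_apply_toTheta]
  exact congrArg Dβ.toTheta (γ.apply_symm_apply y).symm

/-- **L10 (conditional).** If `toTheta` is a topological QUOTIENT map on both sides (a datum the root
interface does not record — sub-DAG debt R3), the algebraic companion is a homeomorphism.
[cite: MochizukiEtTh2009, Thm 1.6 (ii) p.24] -/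
def topCompanion (hqα : IsQuotientMap Dα.toTheta) (hqβ : IsQuotientMap Dβ.toTheta) :
    Dα.GtpTheta ≃ₜ* Dβ.GtpTheta :=
  { (algCompanion Dα Dβ γ hΔ) with
    continuous_toFun := by
      change Continuous (algCompanion Dα Dβ γ hΔ)
      rw [hqα.continuous_iff]
      have : (algCompanion Dα Dβ γ hΔ) ∘ Dα.toTheta = Dβ.toTheta ∘ γ.toMulEquiv :=
        funext fun x => algCompanion_apply_toTheta Dα Dβ γ hΔ x
      rw [this]
      exact Dβ.continuous_toTheta.comp γ.continuous
    continuous_invFun := by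
      change Continuous (algCompanion Dα Dβ γ hΔ).symm
      rw [hqβ.continuous_iff]
      have : (algCompanion Dα Dβ γ hΔ).symm ∘ Dβ.toTheta = Dα.toTheta ∘ γ.symm.toMulEquiv :=
        funext fun y => algCompanion_symm_apply_toTheta Dα Dβ γ hΔ y
      rw [this]
      exact Dα.continuous_toTheta.comp γ.symm.continuous }

/-- `topCompanion` is `algCompanion` on elements. [cite: MochizukiEtTh2009, Thm 1.6 (ii) p.24] -/
@[simp] theorem topCompanion_apply (hqα : IsQuotientMap Dα.toTheta) (hqβ : IsQuotientMap Dβ.toTheta)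
    (g : Dα.GtpTheta) : topCompanion Dα Dβ γ hΔ hqα hqβ g = algCompanion Dα Dβ γ hΔ g := rfl

/-- **L10 (conditional).** Under the quotient-map hypotheses the algebraic companion yields
abc-iut-L2-t1's `ThetaCompanion γ` (all three fields). [cite: MochizukiEtTh2009, Thm 1.6 (ii) p.24] -/
def thetaCompanion_of_isQuotientMap (hqα : IsQuotientMap Dα.toTheta) (hqβ : IsQuotientMap Dβ.toTheta) :
    ThetaSetting.ThetaCompanion γ where
  thetaIso := topCompanion Dα Dβ γ hΔ hqα hqβ
  comm x := (algCompanion_apply_toTheta Dα Dβ γ hΔ x).symm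
  map_deltaTheta := algCompanion_map_deltaTheta Dα Dβ γ hΔ

end Companion

end Thm16Sub

end Literature.AnabelianGeometry.EtaleTheta

end
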